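import Summits.KontsevichZagierPeriods.Zeta5Search.Barrier.ConeGammaS7Gamma

/-!
# ζ(5) search — BARRIER: BZ's §5 system in symmetric coordinates (the `x`-block / `y`-block / `s₆` form)

HONEST FRAMING (cell `pub-zeta5`): systematic search; no irrationality claim unless kernel-certified. MODEL objects
under Brown–Zudilin's (28)+(30) accounting ([BZ22] = arXiv:2210.03391; (28) observed, not proved); coordinate
book-keeping for BZ's §5 critical system (tree: `ConeGammaRates`); nothing here is a statement about `ζ(5)`, the
cone's supremum (C2 OPEN) or S-E (CONJECTURED). No number or sentence of record moves. Records in print UNMOVED.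
Prover P2 g21 (self-selected Lean-only item, file 2).

For a direction `aOfS s` with symmetric parameters `s = (s₀; s₁, …, s₇)`:
* `pR_aOfS`, `qR_aOfS` — `p = (s₄+s₆, s₃+s₆, s₅+s₆, s₀+s₆, s₆+s₇, s₂+s₆, s₁+s₆)`, `q = (s₀−s₃, s₃+s₄, s₁+s₄, s₁+s₂, s₀−s₂)`;
* `F1R_aOfS`, `F2R_aOfS`, `critFactors_aOfS` — the system and the twelve factors in these coordinates
  (`x`-block `{s₃,s₄,s₅}`, `y`-block `{s₁,s₂,s₇}`, special parameter `s₆`);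
* `growthLogR_eq` — the growth functional as its nineteen printed terms (`Real.log |t| = Real.log t`);
  `growthLogR_aOfS` — the same in symmetric coordinates;
* `permS_swap45_apply`, `permS_swap23_apply`, `permS_swap34_apply`, `permS_mirror_apply` — the four generators
  `(56)`, `(34)`, `(45)` (as `Equiv.swap` on `Fin 7`, 0-based) and BZ's reversal `π = (14)(23)(57)` acting on `s`;
* `permAct_aOfS` — `g·(aOfS s) = aOfS (permS g s)`.
-/

noncomputable section

open Finset

namespace Summit.KontsevichZagierPeriods.Zeta5Search.Barrier.ConeGamma

/-! ### `(p;q)`, the system and the factors in symmetric coordinates -/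

/-- `p(aOfS s) = (s₄+s₆, s₃+s₆, s₅+s₆, s₀+s₆, s₆+s₇, s₂+s₆, s₁+s₆)`. -/
theorem pR_aOfS (s : Fin 8 → ℝ) :
    pR (aOfS s) = ![s 4 + s 6, s 3 + s 6, s 5 + s 6, s 0 + s 6, s 6 + s 7, s 2 + s 6, s 1 + s 6] := by
  ext i; fin_cases i
  all_goals simp only [pR, aOfS, Matrix.cons_val, Fin.isValue, Matrix.cons_val_zero, Fin.zero_eta, Fin.mk_one,
    Matrix.cons_val_one, Fin.reduceFinMk]
  all_goals ring

/-- `q(aOfS s) = (s₀−s₃, s₃+s₄, s₁+s₄, s₁+s₂, s₀−s₂)`. -/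
theorem qR_aOfS (s : Fin 8 → ℝ) : qR (aOfS s) = ![s 0 - s 3, s 3 + s 4, s 1 + s 4, s 1 + s 2, s 0 - s 2] := by
  ext i; fin_cases i
  all_goals simp only [qR, aOfS, Matrix.cons_val, Fin.isValue, Matrix.cons_val_zero, Fin.zero_eta, Fin.mk_one,
    Matrix.cons_val_one, Fin.reduceFinMk]
  all_goals ring

/-- `F₁` in symmetric coordinates. -/
theorem F1R_aOfS (s : Fin 8 → ℝ) (x y : ℝ) :
    F1R (pR (aOfS s)) (qR (aOfS s)) x y
      = x * (s 0 + s 6 - x) * (s 3 + s 4 + s 5 + s 6 - x) * (x + y - 2 * s 6)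
        - (x - (s 4 + s 6)) * (x - (s 3 + s 6)) * (x - (s 5 + s 6)) * (x + y - (s 0 + s 6)) := by
  rw [F1R, pR_aOfS, qR_aOfS]; simp only [Matrix.cons_val_zero, Matrix.cons_val_one, Matrix.cons_val]; ring

/-- `F₂` in symmetric coordinates. -/
theorem F2R_aOfS (s : Fin 8 → ℝ) (x y : ℝ) :
    F2R (pR (aOfS s)) (qR (aOfS s)) x y
      = (x + y - 2 * s 6) * (s 1 + s 2 + s 6 + s 7 - y) * (s 0 + s 6 - y) * y
        - (x + y - (s 0 + s 6)) * (y - (s 6 + s 7)) * (y - (s 2 + s 6)) * (y - (s 1 + s 6)) := by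
  rw [F2R, pR_aOfS, qR_aOfS]; simp only [Matrix.cons_val_zero, Matrix.cons_val]; ring

/-- The twelve factors in symmetric coordinates. -/
theorem critFactors_aOfS (s : Fin 8 → ℝ) (x y : ℝ) :
    critFactors (pR (aOfS s)) (qR (aOfS s)) x y
      = ![x - (s 4 + s 6), x - (s 3 + s 6), x - (s 5 + s 6), x + y - (s 0 + s 6), s 0 + s 6 - x,
          s 3 + s 4 + s 5 + s 6 - x, x + y - 2 * s 6, y - (s 6 + s 7), y - (s 2 + s 6), y - (s 1 + s 6),
          s 1 + s 2 + s 6 + s 7 - y, s 0 + s 6 - y] := by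
  rw [pR_aOfS, qR_aOfS]
  ext k; fin_cases k
  all_goals simp only [critFactors, Matrix.cons_val, Fin.isValue, Matrix.cons_val_zero, Fin.zero_eta, Fin.mk_one,
    Matrix.cons_val_one, Fin.reduceFinMk]
  all_goals ring

/-- The growth functional as its nineteen printed terms (absolute values dropped: `Real.log |t| = Real.log t`). -/
theorem growthLogR_eq (p : Fin 7 → ℝ) (q : Fin 5 → ℝ) (x y : ℝ) :
    growthLogR p q x y
      = p 0 * Real.log (x - p 0) + p 1 * Real.log (x - p 1) + p 2 * Real.log (x - p 2)
        + p 3 * Real.log (x + y - p 3) - (p 1 + q 0) * Real.log (p 1 + q 0 - x)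
        - (p 2 + q 1) * Real.log (p 2 + q 1 - x) - (p 0 + p 6 - q 2) * Real.log (x + y + q 2 - p 0 - p 6)
        + p 4 * Real.log (y - p 4) + p 5 * Real.log (y - p 5) + p 6 * Real.log (y - p 6)
        - (p 4 + q 3) * Real.log (p 4 + q 3 - y) - (p 5 + q 4) * Real.log (p 5 + q 4 - y)
        + q 0 * Real.log (q 0) + q 1 * Real.log (q 1) + q 3 * Real.log (q 3) + q 4 * Real.log (q 4)
        - p 0 * Real.log (p 0) - (p 3 + q 2 - p 0 - p 6) * Real.log (p 3 + q 2 - p 0 - p 6)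
        - p 6 * Real.log (p 6) := by
  simp [growthLogR, critExps, critFactors, constArgs, constSigns, Fin.sum_univ_succ, Real.log_abs]
  ring

/-- The growth functional in symmetric coordinates. -/
theorem growthLogR_aOfS (s : Fin 8 → ℝ) (x y : ℝ) :
    growthLogR (pR (aOfS s)) (qR (aOfS s)) x y
      = (s 4 + s 6) * Real.log (x - (s 4 + s 6)) + (s 3 + s 6) * Real.log (x - (s 3 + s 6))
        + (s 5 + s 6) * Real.log (x - (s 5 + s 6)) + (s 0 + s 6) * Real.log (x + y - (s 0 + s 6))
        - (s 0 + s 6) * Real.log (s 0 + s 6 - x) - (s 3 + s 4 + s 5 + s 6) * Real.log (s 3 + s 4 + s 5 + s 6 - x)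
        - 2 * s 6 * Real.log (x + y - 2 * s 6)
        + (s 6 + s 7) * Real.log (y - (s 6 + s 7)) + (s 2 + s 6) * Real.log (y - (s 2 + s 6))
        + (s 1 + s 6) * Real.log (y - (s 1 + s 6)) - (s 1 + s 2 + s 6 + s 7) * Real.log (s 1 + s 2 + s 6 + s 7 - y)
        - (s 0 + s 6) * Real.log (s 0 + s 6 - y)
        + (s 0 - s 3) * Real.log (s 0 - s 3) + (s 3 + s 4) * Real.log (s 3 + s 4) + (s 1 + s 2) * Real.log (s 1 + s 2)
        + (s 0 - s 2) * Real.log (s 0 - s 2) - (s 4 + s 6) * Real.log (s 4 + s 6) - (s 0 - s 6) * Real.log (s 0 - s 6)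
        - (s 1 + s 6) * Real.log (s 1 + s 6) := by
  rw [growthLogR_eq, pR_aOfS, qR_aOfS]
  simp only [Matrix.cons_val_zero, Matrix.cons_val_one, Matrix.cons_val]
  have e1 : s 3 + s 6 + (s 0 - s 3) - x = s 0 + s 6 - x := by ring
  have e2 : s 5 + s 6 + (s 3 + s 4) - x = s 3 + s 4 + s 5 + s 6 - x := by ring
  have e3 : x + y + (s 1 + s 4) - (s 4 + s 6) - (s 1 + s 6) = x + y - 2 * s 6 := by ring
  have e4 : s 6 + s 7 + (s 1 + s 2) - y = s 1 + s 2 + s 6 + s 7 - y := by ring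
  have e5 : s 2 + s 6 + (s 0 - s 2) - y = s 0 + s 6 - y := by ring
  have e6 : s 0 + s 6 + (s 1 + s 4) - (s 4 + s 6) - (s 1 + s 6) = s 0 - s 6 := by ring
  rw [e1, e2, e3, e4, e5, e6]
  ring

/-! ### The generators acting on symmetric parameters -/

/-- `g·(aOfS s) = aOfS (g·s)`. -/
theorem permAct_aOfS (g : Equiv.Perm (Fin 7)) (s : Fin 8 → ℝ) : permAct g (aOfS s) = aOfS (permS g s) := by
  simp [permAct, sParam_aOfS]


/-- `(56)`: `Equiv.swap 4 5` on `Fin 7` swaps `s₅` and `s₆`. -/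
theorem permS_swap45_apply (s : Fin 8 → ℝ) :
    permS (Equiv.swap 4 5) s 0 = s 0 ∧ permS (Equiv.swap 4 5) s 1 = s 1 ∧ permS (Equiv.swap 4 5) s 2 = s 2
      ∧ permS (Equiv.swap 4 5) s 3 = s 3 ∧ permS (Equiv.swap 4 5) s 4 = s 4 ∧ permS (Equiv.swap 4 5) s 5 = s 6
      ∧ permS (Equiv.swap 4 5) s 6 = s 5 ∧ permS (Equiv.swap 4 5) s 7 = s 7 := by
  refine ⟨?_, ?_, ?_, ?_, ?_, ?_, ?_, ?_⟩ <;> simp [permS_apply, Equiv.swap_apply_def]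

/-- `(34)`: `Equiv.swap 2 3` on `Fin 7` swaps `s₃` and `s₄`. -/
theorem permS_swap23_apply (s : Fin 8 → ℝ) :
    permS (Equiv.swap 2 3) s 0 = s 0 ∧ permS (Equiv.swap 2 3) s 1 = s 1 ∧ permS (Equiv.swap 2 3) s 2 = s 2
      ∧ permS (Equiv.swap 2 3) s 3 = s 4 ∧ permS (Equiv.swap 2 3) s 4 = s 3 ∧ permS (Equiv.swap 2 3) s 5 = s 5
      ∧ permS (Equiv.swap 2 3) s 6 = s 6 ∧ permS (Equiv.swap 2 3) s 7 = s 7 := by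
  refine ⟨?_, ?_, ?_, ?_, ?_, ?_, ?_, ?_⟩ <;> simp [permS_apply, Equiv.swap_apply_def]

/-- `(45)`: `Equiv.swap 3 4` on `Fin 7` swaps `s₄` and `s₅`. -/
theorem permS_swap34_apply (s : Fin 8 → ℝ) :
    permS (Equiv.swap 3 4) s 0 = s 0 ∧ permS (Equiv.swap 3 4) s 1 = s 1 ∧ permS (Equiv.swap 3 4) s 2 = s 2
      ∧ permS (Equiv.swap 3 4) s 3 = s 3 ∧ permS (Equiv.swap 3 4) s 4 = s 5 ∧ permS (Equiv.swap 3 4) s 5 = s 4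
      ∧ permS (Equiv.swap 3 4) s 6 = s 6 ∧ permS (Equiv.swap 3 4) s 7 = s 7 := by
  refine ⟨?_, ?_, ?_, ?_, ?_, ?_, ?_, ?_⟩ <;> simp [permS_apply, Equiv.swap_apply_def]

/-- BZ's REVERSAL `π = (14)(23)(57)` (on `Fin 7`: `swap 0 3 * swap 1 2 * swap 4 6`): `s ↦ (s₀; s₄, s₃, s₂, s₁, s₇, s₆, s₅)`;
it sends `p ↦ (p₆,…,p₀)`, `q ↦ (q₅,…,q₁)`. -/
theorem permS_mirror_apply (s : Fin 8 → ℝ) :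
    permS (Equiv.swap 0 3 * Equiv.swap 1 2 * Equiv.swap 4 6) s 0 = s 0
      ∧ permS (Equiv.swap 0 3 * Equiv.swap 1 2 * Equiv.swap 4 6) s 1 = s 4
      ∧ permS (Equiv.swap 0 3 * Equiv.swap 1 2 * Equiv.swap 4 6) s 2 = s 3
      ∧ permS (Equiv.swap 0 3 * Equiv.swap 1 2 * Equiv.swap 4 6) s 3 = s 2
      ∧ permS (Equiv.swap 0 3 * Equiv.swap 1 2 * Equiv.swap 4 6) s 4 = s 1
      ∧ permS (Equiv.swap 0 3 * Equiv.swap 1 2 * Equiv.swap 4 6) s 5 = s 7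
      ∧ permS (Equiv.swap 0 3 * Equiv.swap 1 2 * Equiv.swap 4 6) s 6 = s 6
      ∧ permS (Equiv.swap 0 3 * Equiv.swap 1 2 * Equiv.swap 4 6) s 7 = s 5 := by
  refine ⟨?_, ?_, ?_, ?_, ?_, ?_, ?_, ?_⟩ <;> simp [permS_apply, Equiv.swap_apply_def, Equiv.Perm.mul_apply]

/-- The seventeen `F`-forms of `aOfS s` under any `f`. -/
theorem sum_FIdx_aOfS (s : Fin 8 → ℝ) (f : ℝ → ℝ) :
    ∑ i ∈ FIdx, f (h28 (aOfS s) i) = f (s 1 + s 2) + f (s 0 - s 2) + f (s 2 + s 3) + f (s 0 - s 3) + f (s 3 + s 4)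
      + f (s 5 + s 6) + f (s 6 + s 7) + f (s 1 + s 3) + f (s 1 + s 4) + f (s 1 + s 5) + f (s 2 + s 6)
      + f (s 2 + s 4) + f (s 2 + s 5) + f (s 3 + s 7) + f (s 3 + s 6) + f (s 5 + s 7) + f (s 4 + s 7) := by
  rw [h28_aOfS]
  simp [FIdx, Matrix.cons_val]
  ring

/-- The F-entropy `Σ_{i∈F} h_i log h_i` of `aOfS s`, written out. -/
theorem sum_FIdx_mul_log_aOfS (s : Fin 8 → ℝ) :
    ∑ i ∈ FIdx, h28 (aOfS s) i * Real.log (h28 (aOfS s) i)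
      = (s 1 + s 2) * Real.log (s 1 + s 2) + (s 0 - s 2) * Real.log (s 0 - s 2)
        + (s 2 + s 3) * Real.log (s 2 + s 3) + (s 0 - s 3) * Real.log (s 0 - s 3)
        + (s 3 + s 4) * Real.log (s 3 + s 4) + (s 5 + s 6) * Real.log (s 5 + s 6)
        + (s 6 + s 7) * Real.log (s 6 + s 7) + (s 1 + s 3) * Real.log (s 1 + s 3)
        + (s 1 + s 4) * Real.log (s 1 + s 4) + (s 1 + s 5) * Real.log (s 1 + s 5)
        + (s 2 + s 6) * Real.log (s 2 + s 6) + (s 2 + s 4) * Real.log (s 2 + s 4)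
        + (s 2 + s 5) * Real.log (s 2 + s 5) + (s 3 + s 7) * Real.log (s 3 + s 7)
        + (s 3 + s 6) * Real.log (s 3 + s 6) + (s 5 + s 7) * Real.log (s 5 + s 7)
        + (s 4 + s 7) * Real.log (s 4 + s 7) :=
  sum_FIdx_aOfS s fun t => t * Real.log t

/-- The F-entropy cocycle `ΔE(g; aOfS s)` as a difference of the two entropies. -/
theorem entropyCocycle_aOfS (g : Equiv.Perm (Fin 7)) (s : Fin 8 → ℝ) :
    ∑ i ∈ FIdx, (h28 (permAct g (aOfS s)) i * Real.log (h28 (permAct g (aOfS s)) i)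
        - h28 (aOfS s) i * Real.log (h28 (aOfS s) i))
      = ∑ i ∈ FIdx, h28 (aOfS (permS g s)) i * Real.log (h28 (aOfS (permS g s)) i)
        - ∑ i ∈ FIdx, h28 (aOfS s) i * Real.log (h28 (aOfS s) i) := by
  rw [Finset.sum_sub_distrib, permAct_aOfS]

end Summit.KontsevichZagierPeriods.Zeta5Search.Barrier.ConeGamma

end
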